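import Literature.Claims.NS.Kyritsis2021
import Literature.Analysis.FluidPDE.ClassicalNSBlowupAlternative
import Literature.Analysis.FluidPDE.NSVorticityBKMContinuation
import Literature.Analysis.FluidPDE.ClassicalSobolevUniqueness
import HarnessLib

/-!
# Solo salvage for claim C03b `Kyritsis2021`, Step 1 — the local-theory package (Prop 3.2 + 3.10:
# local existence, uniqueness, global-or-maximal alternative in the Beale–Kato–Majda class, `ν > 0`)
# is TRUE, kernel

Claim skeleton: `Literature/Claims/NS/Kyritsis2021.lean` (claim C03b = K-II pressures argument, cell
`ns-claims`, D-0090; adjudicated #12). Salvage table (`claims/Kyritsis2021/SALVAGE.md` §1, seat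
`ns-claims-salvage-p3`): Step 1 was tabled «classical + cite (Majda–Bertozzi 2002 Thm 3.4 / Cor 3.1 /
Cor 3.2; Tao 2013 Thm 5.4, Cor 5.8); maximal-development glue not assembled». The glue is now a theorem
of the tree — Leray's blow-up alternative for smooth finite-energy solutions
`Literature.Analysis.FluidPDE.finiteEnergy_classical_dichotomy` (p490003) — so this file (seat g3)
discharges the step as typed:

* `kyritsis2021_step1_holds : Step_1` — for `ν > 0` and a smooth divergence-free rapidly decaying
  datum: EITHER a global classical solution with all Sobolev norms bounded on every `[0,T'']` exists, OR
  some classical solution on a half-open slab `[0,T)` in the class on every `[0,T''] ⊂ [0,T)` admits no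
  continuation in the class past `T` (`¬ HasSobolevExtensionPast`); AND classical solutions in the class
  from the same datum agree on their common half-open slab (tree `MajdaBertozzi2002_uniquenessSobolev_holds`,
  Majda–Bertozzi Cor. 3.1).

Proof: `finiteEnergy_classical_dichotomy` + Tao's class on closed sub-slabs
(`IsClassicalNSSolutionOn.hasBoundedSobolevNormsOn_of_sobolevDatum_unforced`) + patching
(`IsClassicalNSSolutionOn.exists_Ici_of_forall_Icc_finiteEnergy`); in the blow-up branch a continuation
in the class past `T*` would restrict to a finite-energy classical solution on the closed slab `[0,T*]`,
which the alternative forbids. Same pattern as `exists_global_classical_of_apriori_gradient_bound`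
(`ClassicalNSGlobalOfEnstrophyBound.lean`). Solo lane (no item).

WHAT THIS IS NOT: not a claim about NS regularity or blow-up; not a claim about any author beyond the
typed locator.
-/

noncomputable section

set_option linter.dupNamespace false

open MeasureTheory Set
open scoped ENNReal NNReal ContDiff

namespace Summit.NavierStokesRegularity.NavierStokesRegularity.Theorems.Kyritsis2021Salvage

open Literature.Analysis.FluidPDE Literature.Claims.NS.Kyritsis2021

/-- Sobolev bounds of a finite-energy classical solution from an `H^∞` datum on every closed slab
`[0,T'']`, `T''` arbitrary (Tao's class for `T'' > 0`; for `T'' ≤ 0` restrict from `[0, S]`). [folklore] -/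
theorem hasBoundedSobolevNormsOn_Icc_of_le {ν S : ℝ} (hν : 0 < ν) (hS : 0 < S)
    {u : ℝ → EuclideanSpace ℝ (Fin 3) → EuclideanSpace ℝ (Fin 3)} {p : ℝ → EuclideanSpace ℝ (Fin 3) → ℝ}
    (hcl : IsClassicalNSSolutionOn (Icc 0 S) ν 0 u p) {A : ℝ≥0∞} (hA : A < ⊤)
    (hE : ∀ t ∈ Icc 0 S, ∫⁻ x, ‖u t x‖ₑ ^ 2 ≤ A)
    (h₀ : ∀ m : ℕ, ∫⁻ x, ‖iteratedFDeriv ℝ m (u 0) x‖ₑ ^ 2 < ⊤) {T'' : ℝ} (hT'' : T'' ≤ S) :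
    HasBoundedSobolevNormsOn (Icc 0 T'') u :=
  (hcl.hasBoundedSobolevNormsOn_of_sobolevDatum_unforced hν hS
    ⟨A.toNNReal, fun t ht => (hE t ht).trans (ENNReal.coe_toNNReal hA.ne).ge⟩ h₀).mono
    (Icc_subset_Icc_right hT'')

/-- **Step 1 of C03b is TRUE** — Prop 3.2 + 3.10 (pp. 7–8, 13): local existence, uniqueness and the
global-or-maximal alternative in the Beale–Kato–Majda class, `ν > 0`, for smooth divergence-free rapidly
decaying data. [cite: Kyritsis2021b, Prop 3.2 pp. 7–8, Prop 3.10 p. 13]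
[cite: MajdaBertozziCUP2002, Thm 3.4 p. 104, Cor 3.1 p. 88, Cor 3.2 p. 112] -/
theorem kyritsis2021_step1_holds : Literature.Claims.NS.Kyritsis2021.Step_1 := by
  intro ν hν u₀ hu₀ hdiv hdecay
  have hdiv' : VectorCalculus.IsDivFree u₀ := fun x => hdiv x
  have hH : ∀ n : ℕ, ∫⁻ x, ‖iteratedFDeriv ℝ n u₀ x‖ₑ ^ 2 < ⊤ := fun n =>
    hdecay.lintegral_enorm_iteratedFDeriv_sq_lt_top n
  refine ⟨?_, ?_⟩
  · -- the global-or-maximal alternative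
    rcases finiteEnergy_classical_dichotomy hν hu₀ hdiv' hH with hall | hbad
    · -- global branch: patch, then read the class off Tao's persistence of regularity
      left
      have hH1 : MemLp (fderiv ℝ u₀) 2 volume := by
        have h1 : ∫⁻ x, ‖fderiv ℝ u₀ x‖ₑ ^ 2 < ⊤ := by
          refine lt_of_le_of_lt (le_of_eq (lintegral_congr fun x => ?_)) (hH 1)
          rw [← ofReal_norm, ← ofReal_norm, norm_iteratedFDeriv_one]
        exact ⟨(hu₀.continuous_fderiv (by simp)).aestronglyMeasurable,
          eLpNorm_two_lt_top_of_lintegral_enorm_sq_lt_top h1⟩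
      obtain ⟨u, p, hcl, hu0, ⟨E, hEtop, hEb⟩, -⟩ :=
        IsClassicalNSSolutionOn.exists_Ici_of_forall_Icc_finiteEnergy hν hH1 hall
      have h₀ : ∀ m : ℕ, ∫⁻ x, ‖iteratedFDeriv ℝ m (u 0) x‖ₑ ^ 2 < ⊤ := by rw [hu0]; exact hH
      refine ⟨u, p, ⟨hcl, fun T'' => ?_⟩, hu0⟩
      have hS : 0 < max T'' 1 := lt_max_of_lt_right one_pos
      exact hasBoundedSobolevNormsOn_Icc_of_le hν hS
        (hcl.mono Icc_subset_Ici_self (uniqueDiffOn_Icc hS)) hEtop (fun t ht => hEb t ht.1) h₀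
        (le_max_left _ _)
    · -- blow-up branch: the maximal solution on `[0,T*)` has no continuation in the class
      right
      obtain ⟨Ts, hTs, u, p, hcl, hu0, ⟨A, hAtop, hE⟩, -, hno⟩ := hbad
      have h₀ : ∀ m : ℕ, ∫⁻ x, ‖iteratedFDeriv ℝ m (u 0) x‖ₑ ^ 2 < ⊤ := by rw [hu0]; exact hH
      have hsob : ∀ T' : ℝ, 0 < T' → T' < Ts → HasBoundedSobolevNormsOn (Icc 0 T') u :=
        fun T' hT' hT'T =>
          hasBoundedSobolevNormsOn_Icc_of_le hν hT'
            (hcl.mono (Icc_subset_Ico_right hT'T) (uniqueDiffOn_Icc hT')) hAtop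
            (fun t ht => hE t ⟨ht.1, ht.2.trans_lt hT'T⟩) h₀ le_rfl
      refine ⟨Ts, hTs, u, p, ⟨hcl, fun T'' hT'' => ?_⟩, hu0, ?_⟩
      · exact (hsob (max T'' (Ts / 2)) (lt_max_of_lt_right (half_pos hTs))
          (max_lt hT'' (half_lt_self hTs))).mono (Icc_subset_Icc_right (le_max_left _ _))
      · rintro ⟨T', hT'Ts, v, q, hv, hvB, hagree⟩
        have hv0 : v 0 = u₀ := by rw [hagree 0 ⟨le_rfl, hTs⟩, hu0]
        obtain ⟨C₀, hC₀⟩ := hvB 0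
        exact hno Ts le_rfl v q (hv.mono (Icc_subset_Ico_right hT'Ts) (uniqueDiffOn_Icc hTs)) hv0
          ⟨C₀, ENNReal.coe_lt_top, fun t ht => by
            rw [lintegral_enorm_sq_eq_lintegral_iteratedFDeriv_zero]; exact hC₀ t ht⟩
  · -- uniqueness in the class on the common half-open slab
    intro T hT u₁ p₁ u₂ p₂ h₁ h₂ h₁0 h₂0 t ht
    set S : ℝ := (t + T) / 2 with hSdef
    have hS0 : 0 < S := by rw [hSdef]; linarith [ht.1]
    have htS : t ≤ S := by rw [hSdef]; linarith [ht.2]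
    have hST : S < T := by rw [hSdef]; linarith [ht.2]
    have hc₁ : IsClassicalNSSolutionOn (Icc 0 S) ν 0 u₁ p₁ :=
      h₁.1.mono (Icc_subset_Ico_right hST) (uniqueDiffOn_Icc hS0)
    have hc₂ : IsClassicalNSSolutionOn (Icc 0 S) ν 0 u₂ p₂ :=
      h₂.1.mono (Icc_subset_Ico_right hST) (uniqueDiffOn_Icc hS0)
    have h0 : u₁ 0 = u₂ 0 := by rw [h₁0, h₂0]
    exact MajdaBertozzi2002_uniquenessSobolev_holds hν.le hS0 hc₁ hc₂ (h₁.2 S hST) (h₂.2 S hST) h0 t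
      ⟨ht.1, htS⟩

end Summit.NavierStokesRegularity.NavierStokesRegularity.Theorems.Kyritsis2021Salvage

end
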